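/-
Copyright: the b2b-balaban T⁴-continuum CRUX team, row NE7b leaf lineage `t4-ne7b-formalise-leaf-06` (gen 156). Project licence.
-/
import Summits.QuantumFields.BalabanUV.T4Continuum.Spine.NE7b.AugmentedHessianEquivalence
import Summits.QuantumFields.BalabanUV.T4Continuum.Spine.NE7b.HardStepChartRadius
import Summits.QuantumFields.BalabanUV.T4Continuum.Spine.NE7b.HardStepBranchDeriv
import Summits.QuantumFields.BalabanUV.T4Continuum.Spine.NE7b.HardStepBranchDerivModulus
import Summits.QuantumFields.BalabanUV.T4Continuum.Spine.NE7b.HardStepActionHessian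
import Summits.QuantumFields.BalabanUV.T4Continuum.Spine.NE7b.HardStepTransportedLetters

/-!
# THE INDUCTIVE STEP WITH THE BRANCH's CONSTRAINED CRITICALITY EXPORTED — the one letter `inductiveStep` kept to itself
# (`DV(σ w)|_{ker D} = 0` on the whole chart ball), needed by the transported-Hessian ENERGY CEILING (row NE7b, node U5c; assembly,
# every parent BY NAME as in HSIS; [folklore])

Cell `pub-balaban`, sub-cell `t4`, spine estimate NE7b (`T4WeightBudget.RelWeightBound`; the cell's OWN estimate — NOT PRINTED in
[Bałaban 1983–89], NOT PROVED).  Crux-route work under `Spine/NE7b/` by a row leaf (`t4-ne7b-formalise-leaf-06` gen 156) in the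
hard-step cell under FREEZE (0)'s crux-prover clause; NOTHING of Bałaban's is named as a Lean object, valued or asserted; no
`T4Continuum/Support` leaf typed; no `def`; zero `sorry`.  Imports: the SIX PARENTS of HSIS directly (AHE, HSCR, HSBD, HSBDM, HSAH, HSTL — all in
the tree), NOT HSIS itself, so that this file does not wait for HSIS's module: it is `inductiveStep`'s assembly re-run verbatim with
one more conjunct (no declaration of HSIS is restated; the three-line kernel-criticality step is inlined).

WHY.  `…TransportedHessianEnergyCeiling` (THEC) bounds the next Hessian `V″(σw)[σ′(w)·, σ′(w)·]` by the energy of ANY test section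
once the branch derivative is `V″(σw)`-orthogonal to `ker D`, and derives that orthogonality from the branch's constrained
criticality on an open chart (`orthogonal_of_criticalBranch`).  HSIS's `inductiveStep` has that criticality in hand (HSCR's output
`hσ`, used for HSAH) but exports only its consequence (d) at the centre.  This file re-runs the SAME assembly and exports the letter
as conjunct (o); nothing else changes.  A successor re-bases HSTT ∕ HSUT on `inductiveStep_critical` and feeds THEC.

WHAT IS PROVED ([folklore] assembly): **`inductiveStep_critical`** — HSIS `inductiveStep`'s hypotheses VERBATIM ⟹ `∃ σ`, `σ(Dδ₀) = δ₀`,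
(o) `∀ w ∈ ball (Dδ₀) ((N⁻¹ − c)r), ∀ κ, Dκ = 0 → fderiv V (σ w) κ = 0`, and (a)–(d) VERBATIM.

NOT HERE (honest): the re-based tower; anything of Bałaban's ((A3) ∕ (A1c), NC-NE7b-α UNRULED).  BY-NAME EFFECT ON THE WALL: NONE.
NE7b NOT PRINTED ∕ NOT PROVED; spine PROVED 0∕9; rung (B)+1 on a FINITE torus — NOT infinite volume, NOT the mass gap, NOT Clay.
HONEST DEPENDENCY: continuum YM on T⁴ ⇐ BetaPertH ∧ nine spine estimates (0∕9 proved); BetaPertH ⇐ (D1) ∧ (D4) ∧ CAP+tail; G-an2-4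
gates asym, D1 and NE2∕3∕4.
-/

set_option autoImplicit false

noncomputable section

namespace Summit.QuantumFields.BalabanUV.T4Continuum.NE7b.HardStepInductiveStepCritical

open Set Filter Topology Function Metric
open scoped NNReal
open Summit.QuantumFields.BalabanUV.T4Continuum.NE7b

variable {E F : Type*} [NormedAddCommGroup E] [InnerProductSpace ℝ E] [CompleteSpace E] [Nontrivial E]
  [NormedAddCommGroup F] [NormedSpace ℝ F]

/-- **ONE INDUCTIVE STEP WITH THE CONSTRAINED-CRITICALITY LETTER EXPORTED.**  Exactly HSIS `inductiveStep` (same hypotheses, same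
conclusions (a)–(d), same proof BY NAME through AHE → HSCR → HSBD → HSBDM → HSAH → HSTL) with ONE more conjunct (o): the branch is
constrained-critical at EVERY point of the chart ball — `∀ w ∈ ball (Dδ₀) ((N⁻¹ − c)r), ∀ κ ∈ ker D, DV(σ w) κ = 0` — HSCR's
`exists_criticalBranch_chart_ker` letter, which `inductiveStep` used internally and did not export.  It is the hypothesis of this
lineage's `…TransportedHessianEnergyCeiling.orthogonal_of_criticalBranch` ∕ `opNorm_transportedHessian_le_on_chart` (the transported
Hessian's SIZE through a test section's energy), so that the energy ceiling can replace HSAH's `‖V″‖‖σ′‖²` along the tower. [folklore] -/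
theorem inductiveStep_critical (D : E →L[ℝ] F) (M : F →L[ℝ] E) (hM : ∀ w, D (M w) = w)
    {V : E → ℝ} {V'' : E → E →L[ℝ] E →L[ℝ] ℝ} {δ₀ : E} {m : ℝ} (hm : 0 < m)
    (hco : ∀ κ, D κ = 0 → m * ‖κ‖ ^ 2 ≤ V'' δ₀ κ κ)
    {N c : ℝ≥0} (hN : (1 + ‖V'' δ₀‖ / m) * ‖M‖ + m⁻¹ ≤ (N : ℝ)) (hc : c < N⁻¹) {r : ℝ} (hr : 0 < r)
    (hVd : ∀ x ∈ closedBall δ₀ r, DifferentiableAt ℝ V x)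
    (hV : ∀ x ∈ closedBall δ₀ r, HasFDerivAt (fderiv ℝ V) (V'' x) x)
    (hVc : ∀ x ∈ closedBall δ₀ r, ‖V'' x - V'' δ₀‖ ≤ c)
    (hcrit0 : fderiv ℝ V δ₀ = 0)
    {M₃ B G : ℝ} (hM₃ : 0 ≤ M₃)
    (hV''lip : ∀ x ∈ closedBall δ₀ r, ∀ x' ∈ closedBall δ₀ r, ‖V'' x - V'' x'‖ ≤ M₃ * ‖x - x'‖)
    (hVB : ∀ x ∈ closedBall δ₀ r, ‖V'' x‖ ≤ B) (hVG : ∀ x ∈ closedBall δ₀ r, ‖fderiv ℝ V x‖ ≤ G) :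
    ∃ σ : F → E, σ (D δ₀) = δ₀ ∧
      -- (o) CONSTRAINED CRITICALITY ALONG THE WHOLE CHART (HSCR's letter, exported)
      (∀ w ∈ ball (D δ₀) (((N : ℝ)⁻¹ - c) * r), ∀ κ : E, D κ = 0 → fderiv ℝ V (σ w) κ = 0) ∧
      -- (a) the branch letters
      (∀ w ∈ ball (D δ₀) (((N : ℝ)⁻¹ - c) * r), σ w ∈ closedBall δ₀ r ∧ DifferentiableAt ℝ σ w ∧
        (∀ k, D (fderiv ℝ σ w k) = k) ∧ ‖fderiv ℝ σ w‖ ≤ ((N : ℝ)⁻¹ - c)⁻¹) ∧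
      (∀ w ∈ ball (D δ₀) (((N : ℝ)⁻¹ - c) * r), ∀ w' ∈ ball (D δ₀) (((N : ℝ)⁻¹ - c) * r),
        ‖σ w - σ w'‖ ≤ ((N : ℝ)⁻¹ - c)⁻¹ * ‖w - w'‖ ∧
        ‖fderiv ℝ σ w - fderiv ℝ σ w'‖ ≤ (((N : ℝ)⁻¹ - c)⁻¹) ^ 2 * M₃ * ((N : ℝ)⁻¹ - c)⁻¹ * ‖w - w'‖) ∧
      -- (b) the first-order letters of `V⁺`
      (∀ w ∈ ball (D δ₀) (((N : ℝ)⁻¹ - c) * r), DifferentiableAt ℝ (V ∘ σ) w ∧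
        ‖fderiv ℝ (V ∘ σ) w‖ ≤ G * ((N : ℝ)⁻¹ - c)⁻¹) ∧
      (∀ w ∈ ball (D δ₀) (((N : ℝ)⁻¹ - c) * r), ∀ w' ∈ ball (D δ₀) (((N : ℝ)⁻¹ - c) * r),
        ‖fderiv ℝ (V ∘ σ) w - fderiv ℝ (V ∘ σ) w'‖ ≤
          (B * ((N : ℝ)⁻¹ - c)⁻¹ * ((N : ℝ)⁻¹ - c)⁻¹ +
            G * ((((N : ℝ)⁻¹ - c)⁻¹) ^ 2 * M₃ * ((N : ℝ)⁻¹ - c)⁻¹)) * ‖w - w'‖) ∧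
      -- (c) the Hessian letters of `V⁺`
      (∀ w ∈ ball (D δ₀) (((N : ℝ)⁻¹ - c) * r),
        HasFDerivAt (fderiv ℝ (V ∘ σ)) ((V'' (σ w)).bilinearComp (fderiv ℝ σ w) (fderiv ℝ σ w)) w ∧
        ‖fderiv ℝ (fderiv ℝ (V ∘ σ)) w‖ ≤ B * (((N : ℝ)⁻¹ - c)⁻¹) ^ 2) ∧
      (∀ w ∈ ball (D δ₀) (((N : ℝ)⁻¹ - c) * r), ∀ w' ∈ ball (D δ₀) (((N : ℝ)⁻¹ - c) * r),
        ‖fderiv ℝ (fderiv ℝ (V ∘ σ)) w - fderiv ℝ (fderiv ℝ (V ∘ σ)) w'‖ ≤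
          M₃ * ((N : ℝ)⁻¹ - c)⁻¹ * (((N : ℝ)⁻¹ - c)⁻¹) ^ 2 * (1 + 2 * B * ((N : ℝ)⁻¹ - c)⁻¹) * ‖w - w'‖) ∧
      -- (d) FULL criticality at the next centre
      fderiv ℝ (V ∘ σ) (D δ₀) = 0 := by
  -- AHE: the chart's equivalence at scale k
  obtain ⟨T, hT, hTN⟩ := AugmentedHessianEquivalence.exists_augHessian_equiv_nnreal (Q := V'' δ₀) hM hm hco hN
  -- HSCR: the critical branch on the closed chart ball
  obtain ⟨σ, hσ0, hσ, hσL, -⟩ := HardStepChartRadius.exists_criticalBranch_chart_ker D T hT hr.le hTN hc hV hVc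
    (fun k _ => by rw [hcrit0]; rfl)
  have hc' : (c : ℝ) < (N : ℝ)⁻¹ := by
    have h := NNReal.coe_lt_coe.2 hc
    rwa [NNReal.coe_inv] at h
  have hpos : (0 : ℝ) < (N : ℝ)⁻¹ - c := sub_pos.2 hc'
  have hK0 : (0 : ℝ) ≤ ((N : ℝ)⁻¹ - c)⁻¹ := inv_nonneg.2 hpos.le
  have hcoe : (((N⁻¹ - c)⁻¹ : ℝ≥0) : ℝ) = ((N : ℝ)⁻¹ - c)⁻¹ := by
    rw [NNReal.coe_inv, NNReal.coe_sub hc.le, NNReal.coe_inv]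
  have hσc : ContinuousOn σ (closedBall (D δ₀) (((N : ℝ)⁻¹ - c) * r)) := hσL.continuousOn
  have hσr : ∀ w ∈ ball (D δ₀) (((N : ℝ)⁻¹ - c) * r), σ w ∈ closedBall δ₀ r := fun w hw =>
    (hσ w (ball_subset_closedBall hw)).1
  have hσLip : ∀ w ∈ ball (D δ₀) (((N : ℝ)⁻¹ - c) * r), ∀ w' ∈ ball (D δ₀) (((N : ℝ)⁻¹ - c) * r),
      ‖σ w - σ w'‖ ≤ ((N : ℝ)⁻¹ - c)⁻¹ * ‖w - w'‖ := by
    intro w hw w' hw'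
    have h := hσL.dist_le_mul w (ball_subset_closedBall hw) w' (ball_subset_closedBall hw')
    rw [dist_eq_norm, dist_eq_norm, hcoe] at h
    exact h
  -- HSBD at every interior point
  have hB := fun w (hw : w ∈ ball (D δ₀) (((N : ℝ)⁻¹ - c) * r)) =>
    HardStepBranchDeriv.hasFDerivAt_criticalBranch_of_chart_ker D T hT hTN hc hV hVc hσ hσc hw
  have hσd : ∀ w ∈ ball (D δ₀) (((N : ℝ)⁻¹ - c) * r), DifferentiableAt ℝ σ w := fun w hw => by
    obtain ⟨A, -, -, hder, -, -, -⟩ := hB w hw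
    exact hder.differentiableAt
  have hσD : ∀ w ∈ ball (D δ₀) (((N : ℝ)⁻¹ - c) * r), ∀ k, D (fderiv ℝ σ w k) = k := fun w hw k => by
    obtain ⟨A, -, -, hder, -, hid, -⟩ := hB w hw
    rw [hder.fderiv]
    exact congrArg (fun L : F →L[ℝ] F => L k) hid
  have hσM : ∀ w ∈ ball (D δ₀) (((N : ℝ)⁻¹ - c) * r), ‖fderiv ℝ σ w‖ ≤ ((N : ℝ)⁻¹ - c)⁻¹ := fun w hw => by
    obtain ⟨A, -, -, hder, hnorm, -, -⟩ := hB w hw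
    rw [hder.fderiv]
    exact hnorm
  have hAw : ∀ w ∈ ball (D δ₀) (((N : ℝ)⁻¹ - c) * r), ∃ A : E ≃L[ℝ] F × (D.ker →L[ℝ] ℝ),
      (∀ h, A h = (D h, (V'' (σ w) h).comp D.ker.subtypeL)) ∧ (∀ z, ‖A.symm z‖ ≤ ((N : ℝ)⁻¹ - c)⁻¹ * ‖z‖) ∧
      HasFDerivAt σ ((A.symm : F × (D.ker →L[ℝ] ℝ) →L[ℝ] E).comp
        (ContinuousLinearMap.inl ℝ F (D.ker →L[ℝ] ℝ))) w := fun w hw => by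
    obtain ⟨A, hA, hAinv, hder, -, -, -⟩ := hB w hw
    exact ⟨A, hA, hAinv, hder⟩
  -- HSBDM: σ′ Lipschitz
  have hσΛ : ∀ w ∈ ball (D δ₀) (((N : ℝ)⁻¹ - c) * r), ∀ w' ∈ ball (D δ₀) (((N : ℝ)⁻¹ - c) * r),
      ‖fderiv ℝ σ w - fderiv ℝ σ w'‖ ≤
        (((N : ℝ)⁻¹ - c)⁻¹) ^ 2 * M₃ * ((N : ℝ)⁻¹ - c)⁻¹ * ‖w - w'‖ := fun w hw w' hw' =>
    HardStepBranchDerivModulus.lipschitzWith_fderiv_of_criticalChart D.ker.subtypeL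
      (Submodule.norm_subtypeL_le _) D hc hM₃ hV''lip hσr hσLip hAw hw hw'
  -- criticality along the branch, V differentiable along the branch
  have hVdσ : ∀ w ∈ ball (D δ₀) (((N : ℝ)⁻¹ - c) * r), DifferentiableAt ℝ V (σ w) := fun w hw =>
    hVd _ (hσr w hw)
  have hcritσ : ∀ w ∈ ball (D δ₀) (((N : ℝ)⁻¹ - c) * r), ∀ κ : E, D κ = 0 → fderiv ℝ V (σ w) κ = 0 :=
    fun w hw κ hκ => (hσ w (ball_subset_closedBall hw)).2.2 κ (LinearMap.mem_ker.2 hκ)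
  -- HSAH: the Hessian of V ∘ σ
  have hH : ∀ w ∈ ball (D δ₀) (((N : ℝ)⁻¹ - c) * r),
      HasFDerivAt (fderiv ℝ (V ∘ σ)) ((V'' (σ w)).bilinearComp (fderiv ℝ σ w) (fderiv ℝ σ w)) w := fun w hw =>
    HardStepActionHessian.hasFDerivAt_fderiv_comp_criticalBranch D hσd hσD hVdσ hcritσ hw (hV _ (hσr w hw))
  have hW : ∀ w ∈ ball (D δ₀) (((N : ℝ)⁻¹ - c) * r),
      fderiv ℝ (fderiv ℝ (V ∘ σ)) w = (V'' (σ w)).bilinearComp (fderiv ℝ σ w) (fderiv ℝ σ w) :=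
    fun w hw => (hH w hw).fderiv
  refine ⟨σ, hσ0, hcritσ, ?_, ?_, ?_, ?_, ?_, ?_, ?_⟩
  · -- (a) pointwise branch letters
    exact fun w hw => ⟨hσr w hw, hσd w hw, hσD w hw, hσM w hw⟩
  · -- (a) two-point branch letters
    exact fun w hw w' hw' => ⟨hσLip w hw w' hw', hσΛ w hw w' hw'⟩
  · -- (b) first order, pointwise (HSTL)
    intro w hw
    exact ⟨(hVdσ w hw).comp w (hσd w hw),
      HardStepTransportedLetters.norm_fderiv_comp_le hVd hVG hσr hσd hσM hw⟩
  · -- (b) first order, two-point (HSTL)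
    intro w hw w' hw'
    have hB0 : 0 ≤ B := (norm_nonneg (V'' (σ w))).trans (hVB _ (hσr w hw))
    exact HardStepTransportedLetters.norm_fderiv_comp_sub_le hB0 hVd hV hVB hVG hσr hσLip hσd hσM hσΛ hw hw'
  · -- (c) Hessian, pointwise (HSAH)
    intro w hw
    refine ⟨hH w hw, ?_⟩
    have h := HardStepActionHessian.norm_hessian_comp_branch_le D (isOpen_ball.mem_nhds hw)
      (fun w' hw' => (hσd w' hw').hasFDerivAt) hσD hVdσ hcritσ (hV _ (hσr w hw))
    refine h.trans ?_
    have hS := hσM w hw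
    have hQ := hVB _ (hσr w hw)
    have hS0 : 0 ≤ ‖fderiv ℝ σ w‖ := norm_nonneg _
    have hB0 : 0 ≤ B := (norm_nonneg (V'' (σ w))).trans hQ
    calc ‖V'' (σ w)‖ * ‖fderiv ℝ σ w‖ ^ 2 ≤ B * (((N : ℝ)⁻¹ - c)⁻¹) ^ 2 := by
          gcongr
      _ = B * (((N : ℝ)⁻¹ - c)⁻¹) ^ 2 := rfl
  · -- (c) Hessian, two-point (HSTL with hW from HSAH)
    intro w hw w' hw'
    exact HardStepTransportedLetters.norm_transportedHessian_sub_le_of_HSBDM hK0 hM₃ hV''lip hVB hσr hσLip hσM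
      hσΛ hW hw hw'
  · -- (d) FULL criticality at the next centre (`0 < r` puts the centre inside the open chart ball)
    have hw0 : D δ₀ ∈ ball (D δ₀) (((N : ℝ)⁻¹ - c) * r) := mem_ball_self (mul_pos hpos hr)
    rw [fderiv_comp (D δ₀) (hVdσ _ hw0) (hσd _ hw0), hσ0, hcrit0, ContinuousLinearMap.zero_comp]

end Summit.QuantumFields.BalabanUV.T4Continuum.NE7b.HardStepInductiveStepCritical

end
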